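import Summits.AtomisticToContinuum.Crystallization.Theses.PhononSlackCertificates
import Summits.AtomisticToContinuum.Crystallization.Theorems.PhononSlackCertificatesAllBadGap
import Summits.AtomisticToContinuum.Crystallization.Theorems.ChargedEnergyGap.Negative.FarCopies
import Literature.MathematicalPhysics.StatisticalMechanics.LennardJonesClusters

/-!
# `FarFieldGapR` (stmt-AtomisticToContinuum-14969), negative side I: the ray witness

Support file for the crux `PhononSlackCertificates.FarFieldGapR` (refuter, cdisprove seat,
cycle 1).  Nothing here closes the item: every theorem is a NEGATION of the crux with one
hypothesis weakened, or a helper.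

* §0 `At δ g C R` — the crux inequality at fixed parameters (`farFieldGapR_iff`, by `Iff.rfl`),
  and three badness lemmas: a lone particle, an ISOLATED particle (nothing within `3/2`) and a
  CROWDED particle (`≥ 19` others within `141/100`) are never `1/20`-good.
* §1 The RAY WITNESS: one particle at the origin facing `K` collinear particles at distances
  `L + k/K` (`1/K`-separated).  Its origin particle is bad with excess site energy
  `≤ -K (L+1)⁻⁶/24 - e*`, unbounded below as `K → ∞`; so (`not_at_of_ray`, `not_at_of_ray_far`):
  - `not_fixedRadius R₀`: the slack radius cannot be fixed before `δ` — for `R₀ = 4` this is the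
    shape of the dropped predecessor `FarFieldGap` (stmt-13957, refuted-misstated), now refuted
    for EVERY radius at once; any proof must let `R(δ) → ∞` as `δ → 0`;
  - `not_uniformC`: the boundary constant cannot be uniform in `δ`; `C(δ) → ∞` as `δ → 0`.

Parts II (`LoadBearing`: separation, badness, monotonicity, `g ≤ -e*`, kill criterion) and III
(`PointwiseFalse`: the pointwise far field is a false strengthening) import this file.
Leans on: `IsTwoShellGood.card_filter_eq_eighteen`, `exists_mem_norm_eq_one`, `eStar`, `e0`,
`lennardJones_zero/one`, Mathlib.  No Prop-valued fact is introduced; all `[folklore]`.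
-/

noncomputable section

namespace Summit.AtomisticToContinuum.Crystallization.Theorems.FarFieldGapRNegative

open scoped BigOperators Classical
open Literature.MathematicalPhysics.StatisticalMechanics Literature.Geometry.DiscreteGeometry
open Summit.AtomisticToContinuum.Crystallization.Theses.PhononSlackCertificates (FarFieldGapR)
open Summit.AtomisticToContinuum.Crystallization.Theorems.ChargedEnergyGapNegative
  (E3 eStar e0 norm_e0)
open Summit.AtomisticToContinuum.Crystallization.Theorems.PhononSlackCertificatesAllBadGap
  (exists_mem_norm_eq_one)

/-! ## §0 The crux, parametrised -/

/-- The far-field inequality at fixed parameters `(δ, g, C, R)`. [folklore] -/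
def At (δ g C R : ℝ) : Prop :=
  ∀ (N : ℕ) (x : Fin N → E3), (∀ i j : Fin N, i ≠ j → δ ≤ dist (x i) (x j)) →
    ∀ U : Finset (Fin N), (∀ i ∈ U, ¬ IsTwoShellGood (1 / 20) (47 / 50) 1 x i) →
      g * (U.card : ℝ) -
          C * (Nat.card {i : Fin N // i ∈ U ∧ ∃ j : Fin N, j ∉ U ∧ dist (x j) (x i) ≤ R} : ℝ) ≤
        ∑ i ∈ U, ((1 / 2 : ℝ) * (∑ j ∈ Finset.univ.erase i, lennardJones (dist (x i) (x j))) -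
          eStar)

/-- `FarFieldGapR` is `∀ δ > 0, ∃ g > 0, ∃ C R, At δ g C R`, by `Iff.rfl`. [folklore] -/
theorem farFieldGapR_iff :
    FarFieldGapR ↔ ∀ δ : ℝ, 0 < δ → ∃ g : ℝ, 0 < g ∧ ∃ C R : ℝ, At δ g C R :=
  Iff.rfl

/-! ### Elementary helpers -/

/-- The boundary count never exceeds `#U`. [folklore] -/
theorem natCard_bdry_le_card {N : ℕ} (x : Fin N → E3) (U : Finset (Fin N)) (R : ℝ) :
    (Nat.card {i : Fin N // i ∈ U ∧ ∃ j : Fin N, j ∉ U ∧ dist (x j) (x i) ≤ R} : ℝ) ≤ U.card := by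
  have h : Nat.card {i : Fin N // i ∈ U ∧ ∃ j : Fin N, j ∉ U ∧ dist (x j) (x i) ≤ R} ≤ U.card := by
    rw [Nat.card_eq_fintype_card, Fintype.card_subtype]
    exact Finset.card_le_card fun i hi => (Finset.mem_filter.1 hi).2.1
  exact_mod_cast h

/-- With a single particle nothing is good (there is nobody to match a pattern point). [folklore] -/
theorem not_isTwoShellGood_fin_one {ε lo hi : ℝ} (x : Fin 1 → E3) (i : Fin 1) :
    ¬ IsTwoShellGood ε lo hi x i := by
  rintro ⟨a, -, -, A, P, f, hP, hf, -, -⟩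
  obtain ⟨v, hv, -⟩ := exists_mem_norm_eq_one hP
  exact (hf v hv).1 (Subsingleton.elim _ _)

/-- **An isolated particle is bad**: if no other particle lies within distance `3/2` of `x i`, then
`i` is not `1/20`-good on the window `[47/50, 1]` (a good particle has a matched first-shell
neighbour within `21a/20 ≤ 21/20`). [folklore] -/
theorem not_isTwoShellGood_of_isolated {N : ℕ} {x : Fin N → E3} {i : Fin N}
    (h : ∀ j : Fin N, j ≠ i → 3 / 2 < dist (x j) (x i)) :
    ¬ IsTwoShellGood (1 / 20) (47 / 50) 1 x i := by
  rintro ⟨a, ha₁, ha₂, A, P, f, hP, hf, -, -⟩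
  obtain ⟨v, hv, hv1⟩ := exists_mem_norm_eq_one hP
  obtain ⟨hne, hd⟩ := hf v hv
  have ha0 : 0 ≤ a := by linarith
  have hAv : dist (x i + a • A v) (x i) = a := by
    rw [dist_eq_norm, add_sub_cancel_left, norm_smul, A.norm_map, hv1, mul_one,
      Real.norm_of_nonneg ha0]
  have h1 : dist (x (f v)) (x i) ≤ 1 / 20 * a + a := by
    calc dist (x (f v)) (x i)
        ≤ dist (x (f v)) (x i + a • A v) + dist (x i + a • A v) (x i) := dist_triangle _ _ _
      _ ≤ 1 / 20 * a + a := by rw [hAv]; exact add_le_add hd le_rfl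
  have h2 := h (f v) hne
  linarith

/-- `√2 ≤ 29/20`, so the route's tolerance `1/20 ≤ 3/2 - √2`. [folklore] -/
theorem one_div_twenty_le : (1 / 20 : ℝ) ≤ 3 / 2 - Real.sqrt 2 := by
  have h : Real.sqrt 2 ≤ 29 / 20 := by
    rw [Real.sqrt_le_left (by norm_num)]
    norm_num
  linarith

/-- **A crowded particle is bad**: if at least `19` other particles lie within distance `141/100`
(`= 3/2 · 47/50 ≤ 3a/2`) of `x i`, then `i` is not good (a good particle has EXACTLY eighteen other
particles within `3a/2`, `IsTwoShellGood.card_filter_eq_eighteen`). [folklore] -/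
theorem not_isTwoShellGood_of_crowded {N : ℕ} {x : Fin N → E3} {i : Fin N} (S : Finset (Fin N))
    (hS : 19 ≤ S.card) (hSi : ∀ j ∈ S, j ≠ i ∧ dist (x j) (x i) ≤ 141 / 100) :
    ¬ IsTwoShellGood (1 / 20) (47 / 50) 1 x i := by
  intro hgood
  obtain ⟨a, ha₁, -, hcard⟩ := hgood.card_filter_eq_eighteen (by norm_num) one_div_twenty_le
  have hsub : S ⊆ Finset.univ.filter fun j : Fin N => j ≠ i ∧ dist (x j) (x i) ≤ 3 / 2 * a := by
    intro j hj
    obtain ⟨hji, hd⟩ := hSi j hj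
    exact Finset.mem_filter.2 ⟨Finset.mem_univ _, hji, hd.trans (by linarith)⟩
  have := Finset.card_le_card hsub
  omega

/-! ## §1 The ray witness (dense collinear matter; separation `1/K`) -/

/-- One particle at the origin and `K` particles on the ray `ℝ₊ e₀` at distances `L + k/K`,
`k < K` (mutual spacing `1/K`, all at distance `∈ [L, L+1)` from the origin). [folklore] -/
def ray (L : ℝ) (K : ℕ) : Fin (K + 1) → E3 :=
  Matrix.vecCons (0 : E3) fun k : Fin K => (L + (k : ℝ) / K) • e0

/-- The origin particle of the ray. [folklore] -/
@[simp] theorem ray_zero (L : ℝ) (K : ℕ) : ray L K 0 = 0 := rfl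

/-- The `k`-th ray particle sits at `(L + k/K) e₀`. [folklore] -/
@[simp] theorem ray_succ (L : ℝ) (K : ℕ) (k : Fin K) :
    ray L K k.succ = (L + (k : ℝ) / K) • e0 := by
  simp [ray]

/-- Distance from the origin to the `k`-th ray particle: `L + k/K`. [folklore] -/
theorem dist_ray_zero_succ {L : ℝ} (hL : 0 ≤ L) (K : ℕ) (k : Fin K) :
    dist (ray L K 0) (ray L K k.succ) = L + (k : ℝ) / K := by
  have h0 : 0 ≤ L + (k : ℝ) / K := by positivity
  rw [ray_zero, ray_succ, dist_zero_left, norm_smul, norm_e0, mul_one, Real.norm_of_nonneg h0]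

/-- Distance between two ray particles: `|j - k|/K`. [folklore] -/
theorem dist_ray_succ_succ (L : ℝ) (K : ℕ) (j k : Fin K) :
    dist (ray L K j.succ) (ray L K k.succ) = |(j : ℝ) - k| / K := by
  rw [ray_succ, ray_succ, dist_eq_norm, ← sub_smul, norm_smul, norm_e0, mul_one, Real.norm_eq_abs,
    show L + (j : ℝ) / K - (L + (k : ℝ) / K) = ((j : ℝ) - k) / K by ring, abs_div, Nat.abs_cast]

/-- The ray configuration is `1/K`-separated (for `L ≥ 1`, `K ≥ 1`). [folklore] -/
theorem ray_separated {L : ℝ} (hL : 1 ≤ L) {K : ℕ} (hK : 0 < K) :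
    ∀ i j : Fin (K + 1), i ≠ j → (1 : ℝ) / K ≤ dist (ray L K i) (ray L K j) := by
  have hK' : (0 : ℝ) < K := by exact_mod_cast hK
  have hK1 : (1 : ℝ) ≤ K := by exact_mod_cast hK
  have hKinv : (1 : ℝ) / K ≤ 1 := by rw [div_le_one hK']; exact hK1
  intro i j hij
  rcases Fin.eq_zero_or_eq_succ i with rfl | ⟨i, rfl⟩ <;>
    rcases Fin.eq_zero_or_eq_succ j with rfl | ⟨j, rfl⟩
  · exact absurd rfl hij
  · rw [dist_ray_zero_succ (by linarith)]
    have : (0 : ℝ) ≤ (j : ℝ) / K := by positivity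
    linarith
  · rw [dist_comm, dist_ray_zero_succ (by linarith)]
    have : (0 : ℝ) ≤ (i : ℝ) / K := by positivity
    linarith
  · rw [dist_ray_succ_succ]
    have hij' : i ≠ j := fun h => hij (by rw [h])
    have hne : (i : ℕ) ≠ (j : ℕ) := Fin.val_ne_of_ne hij'
    have h1 : (1 : ℝ) ≤ |(i : ℝ) - j| := by
      rcases Nat.lt_or_gt_of_ne hne with h | h
      · have : (i : ℝ) + 1 ≤ j := by exact_mod_cast h
        rw [abs_of_nonpos (by linarith)]
        linarith
      · have : (j : ℝ) + 1 ≤ i := by exact_mod_cast h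
        rw [abs_of_nonneg (by linarith)]
        linarith
    exact div_le_div_of_nonneg_right h1 hK'.le

/-- Every other particle of the ray is at distance `≥ L` from the origin particle. [folklore] -/
theorem le_dist_ray_zero {L : ℝ} (hL : 0 ≤ L) (K : ℕ) :
    ∀ j : Fin (K + 1), j ≠ 0 → L ≤ dist (ray L K j) (ray L K 0) := by
  intro j hj
  obtain ⟨k, rfl⟩ := Fin.exists_succ_eq.2 hj
  rw [dist_comm, dist_ray_zero_succ hL]
  have : (0 : ℝ) ≤ (k : ℝ) / K := by positivity
  linarith

/-- For `L > 3/2` the origin particle of the ray is bad (isolated). [folklore] -/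
theorem ray_zero_bad {L : ℝ} (hL : 3 / 2 < L) (K : ℕ) :
    ¬ IsTwoShellGood (1 / 20) (47 / 50) 1 (ray L K) 0 :=
  not_isTwoShellGood_of_isolated fun j hj => hL.trans_le (le_dist_ray_zero (by linarith) K j hj)

/-- For `K ≥ 20` every ray particle is bad: the origin is isolated and each of the `K` ray
particles has the other `K - 1 ≥ 19` within distance `< 1`. [folklore] -/
theorem ray_all_bad {L : ℝ} (hL : 3 / 2 < L) {K : ℕ} (hK : 20 ≤ K) :
    ∀ j : Fin (K + 1), ¬ IsTwoShellGood (1 / 20) (47 / 50) 1 (ray L K) j := by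
  intro j
  rcases Fin.eq_zero_or_eq_succ j with rfl | ⟨k, rfl⟩
  · exact ray_zero_bad hL K
  · have hK' : (0 : ℝ) < K := by exact_mod_cast (show 0 < K by omega)
    refine not_isTwoShellGood_of_crowded ((Finset.univ.image Fin.succ).erase k.succ) ?_ ?_
    · rw [Finset.card_erase_of_mem (Finset.mem_image_of_mem _ (Finset.mem_univ k)),
        Finset.card_image_of_injective _ (Fin.succ_injective _), Finset.card_univ, Fintype.card_fin]
      omega
    · intro j hj
      obtain ⟨hjk, hj'⟩ := Finset.mem_erase.1 hj
      obtain ⟨i, -, rfl⟩ := Finset.mem_image.1 hj'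
      refine ⟨hjk, ?_⟩
      rw [dist_ray_succ_succ]
      have hi : ((i : ℕ) : ℝ) < K := by exact_mod_cast i.2
      have hk : ((k : ℕ) : ℝ) < K := by exact_mod_cast k.2
      have hi0 : (0 : ℝ) ≤ (i : ℕ) := Nat.cast_nonneg _
      have hk0 : (0 : ℝ) ≤ (k : ℕ) := Nat.cast_nonneg _
      have hlt : |(i : ℝ) - k| < K := by
        rw [abs_sub_lt_iff]; constructor <;> linarith
      have : |(i : ℝ) - k| / K < 1 := by rwa [div_lt_one hK']
      linarith

/-- `V_LJ(s) ≤ -t⁻⁶/12` for `1 ≤ s ≤ t` (`u² ≤ u` for `u = s⁻⁶ ≤ 1`). [folklore] -/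
theorem lennardJones_le_of_one_le {s t : ℝ} (hs : 1 ≤ s) (hst : s ≤ t) :
    lennardJones s ≤ -((t⁻¹) ^ 6 / 12) := by
  unfold lennardJones
  have h0 : 0 < s := by linarith
  have hu1 : (s⁻¹) ^ 6 ≤ 1 := pow_le_one₀ (inv_nonneg.2 h0.le) (inv_le_one_of_one_le₀ hs)
  have hu0 : 0 ≤ (s⁻¹) ^ 6 := pow_nonneg (inv_nonneg.2 h0.le) 6
  have hut : (t⁻¹) ^ 6 ≤ (s⁻¹) ^ 6 :=
    pow_le_pow_left₀ (inv_nonneg.2 (by linarith)) (inv_anti₀ h0 hst) 6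
  have h12 : (s⁻¹) ^ 12 = ((s⁻¹) ^ 6) ^ 2 := by ring
  have hsq : ((s⁻¹) ^ 6) ^ 2 ≤ (s⁻¹) ^ 6 := by nlinarith
  rw [h12]
  linarith

/-- The site energy of the origin particle of the ray: `K` attractive bonds, each `≤ -(L+1)⁻⁶/12`.
[folklore] -/
theorem ray_site_sum_le {L : ℝ} (hL : 1 ≤ L) {K : ℕ} (hK : 0 < K) :
    ∑ j ∈ Finset.univ.erase (0 : Fin (K + 1)), lennardJones (dist (ray L K 0) (ray L K j)) ≤
      -((K : ℝ) * ((L + 1)⁻¹) ^ 6) / 12 := by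
  have hK' : (0 : ℝ) < K := by exact_mod_cast hK
  have h0 : lennardJones (dist (ray L K 0) (ray L K 0)) = 0 := by simp [lennardJones_zero]
  have h1 : ∑ j ∈ Finset.univ.erase (0 : Fin (K + 1)), lennardJones (dist (ray L K 0) (ray L K j)) =
      ∑ j : Fin (K + 1), lennardJones (dist (ray L K 0) (ray L K j)) := by
    rw [← Finset.add_sum_erase _ _ (Finset.mem_univ (0 : Fin (K + 1))), h0, zero_add]
  rw [h1, Fin.sum_univ_succ, h0, zero_add]
  have hterm : ∀ k : Fin K,
      lennardJones (dist (ray L K 0) (ray L K k.succ)) ≤ -(((L + 1)⁻¹) ^ 6 / 12) := by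
    intro k
    rw [dist_ray_zero_succ (by linarith) K k]
    refine lennardJones_le_of_one_le ?_ ?_
    · have : (0 : ℝ) ≤ (k : ℝ) / K := by positivity
      linarith
    · have hk : ((k : ℕ) : ℝ) < K := by exact_mod_cast k.2
      have : (k : ℝ) / K ≤ 1 := by rw [div_le_one hK']; exact hk.le
      linarith
  calc ∑ k : Fin K, lennardJones (dist (ray L K 0) (ray L K k.succ))
      ≤ ∑ _k : Fin K, -(((L + 1)⁻¹) ^ 6 / 12) := Finset.sum_le_sum fun k _ => hterm k
    _ = -((K : ℝ) * ((L + 1)⁻¹) ^ 6) / 12 := by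
        rw [Finset.sum_const, Finset.card_univ, Fintype.card_fin, nsmul_eq_mul]; ring

/-- The right-hand side of the crux for the ray and `U = {0}`. [folklore] -/
theorem ray_sum_le {L : ℝ} (hL : 1 ≤ L) {K : ℕ} (hK : 0 < K) :
    ∑ i ∈ ({0} : Finset (Fin (K + 1))),
        ((1 / 2 : ℝ) * (∑ j ∈ Finset.univ.erase i, lennardJones (dist (ray L K i) (ray L K j))) -
          eStar) ≤ -((K : ℝ) * ((L + 1)⁻¹) ^ 6) / 24 - eStar := by
  rw [Finset.sum_singleton]
  have := ray_site_sum_le hL hK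
  linarith

/-- Beyond the slack radius the origin particle has EMPTY boundary (`R < L`). [folklore] -/
theorem ray_bdry_eq_zero {L R : ℝ} (hRL : R < L) (hL : 0 ≤ L) (K : ℕ) :
    Nat.card {i : Fin (K + 1) // i ∈ ({0} : Finset (Fin (K + 1))) ∧
      ∃ j : Fin (K + 1), j ∉ ({0} : Finset (Fin (K + 1))) ∧ dist (ray L K j) (ray L K i) ≤ R} = 0 := by
  haveI : IsEmpty {i : Fin (K + 1) // i ∈ ({0} : Finset (Fin (K + 1))) ∧
      ∃ j : Fin (K + 1), j ∉ ({0} : Finset (Fin (K + 1))) ∧ dist (ray L K j) (ray L K i) ≤ R} := by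
    refine ⟨fun ⟨i, hi, j, hj, hd⟩ => ?_⟩
    rw [Finset.mem_singleton] at hi hj
    subst hi
    have := le_dist_ray_zero hL K j hj
    linarith
  exact Nat.card_of_isEmpty

/-- From `24 (B - e*) (L+1)^6 < K`: the ray's right-hand side is below `-B`. [folklore] -/
theorem ray_arith {B L : ℝ} {K : ℕ} (hL : 0 ≤ L) (hbig : 24 * (B - eStar) * (L + 1) ^ 6 < K) :
    -((K : ℝ) * ((L + 1)⁻¹) ^ 6) / 24 - eStar < -B := by
  have hL1 : (0 : ℝ) < L + 1 := by linarith
  have ht : (L + 1) ^ 6 * ((L + 1)⁻¹) ^ 6 = 1 := by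
    rw [← mul_pow, mul_inv_cancel₀ hL1.ne']; norm_num
  have htpos : (0 : ℝ) < ((L + 1)⁻¹) ^ 6 := by positivity
  have h1 : 24 * (B - eStar) < (K : ℝ) * ((L + 1)⁻¹) ^ 6 := by
    have := mul_lt_mul_of_pos_right hbig htpos
    calc 24 * (B - eStar) = 24 * (B - eStar) * ((L + 1) ^ 6 * ((L + 1)⁻¹) ^ 6) := by
          rw [ht, mul_one]
      _ = 24 * (B - eStar) * (L + 1) ^ 6 * ((L + 1)⁻¹) ^ 6 := by ring
      _ < K * ((L + 1)⁻¹) ^ 6 := this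
  linarith

/-- **The ray kills `At δ g C R` whenever `δ ≤ 1/K`, `L ≥ 2` and `24 (|C| - e*) (L+1)^6 < K`**
(`U = {origin}`: bad, boundary count `≤ 1`, excess site energy `≤ -K (L+1)⁻⁶/24 - e* < -|C|`).
[folklore] -/
theorem not_at_of_ray {δ g C R L : ℝ} {K : ℕ} (hK : 0 < K) (hδ : δ ≤ 1 / K) (hL : 2 ≤ L)
    (hg : 0 < g) (hbig : 24 * (|C| - eStar) * (L + 1) ^ 6 < K) : ¬ At δ g C R := by
  intro h
  have key := h (K + 1) (ray L K)
    (fun i j hij => hδ.trans (ray_separated (by linarith) hK i j hij)) {0}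
    (fun i hi => by rw [Finset.mem_singleton] at hi; subst hi; exact ray_zero_bad (by linarith) K)
  rw [Finset.card_singleton] at key
  have hsum := ray_sum_le (by linarith : (1 : ℝ) ≤ L) hK
  have har := ray_arith (by linarith : (0 : ℝ) ≤ L) hbig
  have hb := natCard_bdry_le_card (ray L K) ({0} : Finset (Fin (K + 1))) R
  rw [Finset.card_singleton] at hb
  push_cast at key hb
  have hb0 : (0 : ℝ) ≤ Nat.card {i : Fin (K + 1) // i ∈ ({0} : Finset (Fin (K + 1))) ∧
      ∃ j : Fin (K + 1), j ∉ ({0} : Finset (Fin (K + 1))) ∧ dist (ray L K j) (ray L K i) ≤ R} :=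
    Nat.cast_nonneg _
  have hC : -|C| ≤ -(C * (Nat.card {i : Fin (K + 1) // i ∈ ({0} : Finset (Fin (K + 1))) ∧
      ∃ j : Fin (K + 1), j ∉ ({0} : Finset (Fin (K + 1))) ∧ dist (ray L K j) (ray L K i) ≤ R} : ℝ)) := by
    rw [neg_le_neg_iff]
    calc C * _ ≤ |C| * _ := mul_le_mul_of_nonneg_right (le_abs_self C) hb0
      _ ≤ |C| * 1 := mul_le_mul_of_nonneg_left hb (abs_nonneg C)
      _ = |C| := mul_one _
  linarith

/-- **Far variant**: if moreover the whole ray lies beyond the slack radius (`R < L`), the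
boundary is empty and `24 (-e*) (L+1)^6 < K` suffices, for EVERY `C`. [folklore] -/
theorem not_at_of_ray_far {δ g C R L : ℝ} {K : ℕ} (hK : 0 < K) (hδ : δ ≤ 1 / K) (hL : 2 ≤ L)
    (hRL : R < L) (hg : 0 < g) (hbig : 24 * (0 - eStar) * (L + 1) ^ 6 < K) : ¬ At δ g C R := by
  intro h
  have key := h (K + 1) (ray L K)
    (fun i j hij => hδ.trans (ray_separated (by linarith) hK i j hij)) {0}
    (fun i hi => by rw [Finset.mem_singleton] at hi; subst hi; exact ray_zero_bad (by linarith) K)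
  rw [Finset.card_singleton, ray_bdry_eq_zero hRL (by linarith) K] at key
  have hsum := ray_sum_le (by linarith : (1 : ℝ) ≤ L) hK
  have har := ray_arith (by linarith : (0 : ℝ) ≤ L) hbig
  push_cast at key
  linarith

/-! ### (a1) The slack radius must depend on `δ` — any FIXED radius is refuted

This re-lands, for every radius `R₀` at once, the refutation of the dropped predecessor
`FarFieldGap` (stmt-AtomisticToContinuum-13957, radius `4`). -/

/-- **No fixed slack radius works** (`R` is chosen after `δ` for a reason): at separation
`δ = 1/K` one isolated bad particle with EMPTY `R₀`-boundary, facing `K` collinear particles at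
distances in `[L, L+1)`, `L = max R₀ 2 + 1 > R₀`, has excess site energy
`≤ -K (L+1)⁻⁶/24 - e* < 0 < g` once `K > 24 (-e*) (L+1)^6`.  Any proof must let `R(δ) → ∞` as
`δ → 0` (quantitatively `R(δ) ≳ δ^{-1/6}` from this witness, `≳ δ⁻¹` from a 3-D cloud). [folklore] -/
theorem not_fixedRadius (R₀ : ℝ) :
    ¬ ∀ δ : ℝ, 0 < δ → ∃ g : ℝ, 0 < g ∧ ∃ C : ℝ, At δ g C R₀ := by
  intro h
  set L : ℝ := max R₀ 2 + 1 with hL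
  have hL2 : 2 ≤ L := by rw [hL]; linarith [le_max_right R₀ 2]
  have hRL : R₀ < L := by rw [hL]; linarith [le_max_left R₀ 2]
  obtain ⟨K₀, hK₀⟩ := exists_nat_gt (24 * (0 - eStar) * (L + 1) ^ 6)
  set K : ℕ := K₀ + 1 with hK
  have hKpos : 0 < K := Nat.succ_pos _
  have hbig : 24 * (0 - eStar) * (L + 1) ^ 6 < K := by
    have : (K₀ : ℝ) ≤ K := by rw [hK]; push_cast; linarith
    linarith
  obtain ⟨g, hg, C, hAt⟩ := h (1 / K) (by positivity)
  exact not_at_of_ray_far hKpos le_rfl hL2 hRL hg hbig hAt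

/-! ### (a2) The boundary constant must depend on `δ` -/

/-- **No `δ`-uniform boundary constant works**: at `δ = 1/K` one isolated bad (boundary) particle
facing `K` collinear particles at distances in `[2, 3)` has excess site energy
`≤ -K 3⁻⁶/24 - e* < -|C| ≤ g - C · #∂` once `K > 24 (|C| - e*) 3^6`.  So `C(δ) → ∞` as `δ → 0`
(`C(δ) ≳ δ⁻¹` from this witness; `≳ δ⁻³` from a 3-D shell of neighbours). [folklore] -/
theorem not_uniformC :
    ¬ ∃ C : ℝ, ∀ δ : ℝ, 0 < δ → ∃ g : ℝ, 0 < g ∧ ∃ R : ℝ, At δ g C R := by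
  rintro ⟨C, h⟩
  obtain ⟨K₀, hK₀⟩ := exists_nat_gt (24 * (|C| - eStar) * (2 + 1) ^ 6)
  set K : ℕ := K₀ + 1 with hK
  have hKpos : 0 < K := Nat.succ_pos _
  have hbig : 24 * (|C| - eStar) * ((2 : ℝ) + 1) ^ 6 < K := by
    have : (K₀ : ℝ) ≤ K := by rw [hK]; push_cast; linarith
    linarith
  obtain ⟨g, hg, R, hAt⟩ := h (1 / K) (by positivity)
  exact not_at_of_ray hKpos le_rfl le_rfl hg hbig hAt



end Summit.AtomisticToContinuum.Crystallization.Theorems.FarFieldGapRNegative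

end
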